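import Literature.MathematicalPhysics.QuantumFieldTheory.Balaban1983to89.Node00.Record13
import Literature.MathematicalPhysics.QuantumFieldTheory.Balaban1983to89.Node00.Record13SepCoPH
import Literature.MathematicalPhysics.QuantumFieldTheory.Balaban1983to89.Node00.Record13Carriers
import Literature.MathematicalPhysics.QuantumFieldTheory.Balaban1983to89.Node00.CarriersB8
import Literature.MathematicalPhysics.QuantumFieldTheory.Balaban1983to89.Node00.Record13SClassSepCoPH
import Literature.MathematicalPhysics.QuantumFieldTheory.Balaban1983to89.Node00.N24NodesWindowStage12C
import Literature.MathematicalPhysics.QuantumFieldTheory.Balaban1983to89.T4DatumAssemblyTower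
import Summits.QuantumFields.YangMills.Theses.BalabanUVNodes
import Summits.QuantumFields.YangMills.Theorems.BalabanUVNodesK1BetaWindow13SOfNodes13PWSOfBoxH

/-!
# BalabanUVNodes ∕ K1⁷ — (2.6) [III] AND HENCE THE CRUX's CONSEQUENT NEED ONLY **BOUNDED-BELOW PARTIAL SUMS** OF β (the letter K2⁷'s endpoint road already consumes),
# NOT the sign, NOT asymptotic freedom: `StabilityBAtRecordR13SepCoPH` from the registered STUB 1 and, at every rung-1 witness, `FlowStepRuns.BetaPartialSumsLowerH M γ₀ β_θ` +
# the ceiling `BetaUpperH w.βup γ₀ β_θ` — and therefore from K2⁷'s registered (D1)+(D4) letters at the witness (drift + `AtSlopeCont`, slope condition `s ≤ d`)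

TRACK A (YM-PLAN §2d), node N24 (binder B2, COMPOSITE), WIDTH SEAT `pub-ymgap-dag-n24-w1` (director-ym №197 ∕ HUMAN RULING D-0149; plan g77 W-SEAT-START-LIST v2 §1 n24
ITEM 1, third module).  Key of record: K1⁷ `StabilityBAtRecordR13SepCoPH` = stmt-QuantumFields-20542; `--supports` it AS A HELPER (count-neutral).  Companions: this seat's
`…K1BetaWindow13SOfNodes13PWSOfBoxH` (rung 1 ⇒ rung 2 modulo the AF box) and `…K1EndOfNodes13PWSOfSignBoxH` (the consequent modulo the SIGN box).

THE LOCATED POINT, ONE NOTCH FURTHER.  `B14.lean`'s census (cell GAPS G-r2.1) records: the UPPER bound gives (2.6)'s first member; the SIGN `0 ≤ β_{j+1}(g_j)` gives the last member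
`g_m ≤ (1+β₀) g_n`; «boundedness alone does not give the last member uniformly in `n − m`».  `FlowStepRuns` §7 records for the OTHER half of [Balaban1987RG1] Thm 2 (endpoint
existence) that the sign is NOT necessary — bounded-below partial sums `BetaPartialSumsLowerH M γ` are the exact scale.  THIS FILE proves the same for (2.6)'s last member, hence
for the whole (B)-road of K1⁷: along a run in `]0, γ]` with (0.20), `Σ_{j∈[m,n)} β_{j+1}(g_j) ≥ −M` gives `1/g_m² ≥ 1/g_n² − M ≥ (1+β₀)⁻²/g_n²` as soon as `M·γ² ≤ 1 − (1+β₀)⁻²` —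
and the window CAN ALWAYS BE SHRUNK to meet that (the thirteen nodes are antitone in the window, companion §1; the world's `β₀ > 0` is `WorldP.β₀_pos`).  So the crux's consequent
follows from a rung-1 witness and the TWO letters «partial sums of `betaOfRecord₁₃ θ` bounded below on SOME window» + «the witness's ceiling dominates `betaOfRecord₁₃ θ` on SOME window»
— the first is EXACTLY what K2⁷'s registered pair delivers at θ (drift of the one-loop numbers with slope `d = stepBal`, defect `A`; remainder `|β¹| ≤ s` on the box; `s ≤ d` ⟹
`BetaPartialSumsLowerH 2A γ₀`, `Beta.RemainderResidue.betaPartialSumsLowerH_of_drift_windowedLower` — in K2⁷'s skeleton `s = d = stepBal Nc Lc`), the second is [Balaban1987RG1] §1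
p.264 «uniformly bounded» read against `w.βup` (N26 gives `BetaUpperH (d + 2A + s) γ₀` from the same pair).  NO SIGN, NO AF FLOOR anywhere on this road.

* §1 flow arithmetic ([Balaban1988Convergent] (2.6) p.255 from [Balaban1987RG1] (0.20) p.256): `inv_sq_eq_add_sum_of_rg` (telescoping), `flow26_upper_of_rg_upper` (first member from
  the run-wise ceiling, NO sign condition on `β′` — `Step.B14_2_6a`'s contradiction trick), `flow26_lower_of_rg_partialSumsLower` (last member from run-wise bounded-below partial
  sums + `M·γ² ≤ 1 − (1+β₀)⁻²`), `flowIneq26_of_rg_upper_partialSumsLower` (both).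
* §2 `endStatementBPrinted_of_nodesP_alongRuns_partialSums` — the END headline at a dependence-function world from the thirteen nodes, the guarded (0.20) leaf, the run-wise
  ceiling, the run-wise partial-sum floor `−M` and the smallness `M·w.γ² ≤ 1 − (1+w.β₀)⁻²`.
* §3 box ⟹ run: `partialSums_alongRun_of_betaPartialSumsLowerH`, `upper_alongRun_of_betaUpperH` — at any construction currying a history family `β` (`DagBinding.CurriesHBeta`), the
  box-level letters give the run-wise ones along in-window runs (the run's history extended constantly beyond `K` to a `]0, γ₀]`-sequence; `DagBinding.update_prefixOf_last`).
* §4 ★ `stabilityB_body_of_rung1At_of_partialSumsH_of_ceiling` (general `N`) — from ANY rung-1 datum `(θ, h, w)` and `0 < γ₀`, `BetaPartialSumsLowerH M γ₀ (betaOfRecord₁₃ θ)`,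
  `BetaUpperH w.βup γ₀ (betaOfRecord₁₃ θ)`: the crux's consequent AT θ; the window is shrunk to `min (min w.γ γ₀) √(c∕(M+1))`, `c := 1 − (1+w.β₀)⁻²`, so NO smallness hypothesis
  survives; non-vacuity window by n24-a's `N24_window_of_betaUpperH`.
* §5 ★★★ `stabilityBAtRecordR13SepCoPH_of_stub1_of_partialSumsBox_at_witness` (`N = 2`) — THE ROUTE DECL BY NAME from the registered STUB 1 text (v5 VERBATIM, `RecordS` unfolded) and
  «at every rung-1 witness: `∃ γ₀ M, 0 < γ₀ ∧ BetaPartialSumsLowerH M γ₀ β_θ ∧ BetaUpperH w.βup γ₀ β_θ`» — an ALTERNATIVE kernel-checked composition beside plan's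
  `StabilityBAtRecordR13SepCoPH_of`, the β-side input two notches below rung 2's AF floor.
* The K2⁷-pair compositions (drift + `AtSlopeCont` letters at θ; K2⁷'s two registered stub TEXTS; the route decl from K1⁷ stub 1 + K2⁷ stubs 1 ∧ 2 + the ceiling) are the
  companion module `…K1EndOfNodes13PWSOfK2Pair` (this seat, same lane), which imports this file.

HONEST SCOPE ∕ A6.  Implications only; stub 1, the partial-sum floor, the ceiling and the K2 letters are DISPLAYED HYPOTHESES (K1⁷ stub 1 ∕ K2⁷ ∕ K0⁷ 3ᴬ ∕ NODE O own them), inhabited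
at NO θ here («not exhibited», №167).  The partial-sum floor is UNPRINTED like the sign ([Balaban1987RG1] p.264 defers the β-properties) — the gain is in STRENGTH of the located input
(K2⁷'s own currency now suffices for K1⁷'s β-side), not a discharge.  Nothing of Bałaban asserted; K1⁷ NOT closed; N24 COMPOSITE — no discharge, no count claim (typed 28∕28 ·
discharged 5∕27 unmoved).  One finite 𝕋⁴ programme at fixed ε, Bałaban AS PRINTED; R4 closes ONLY the conditional finite-𝕋⁴ rung `BalabanLadder.UV` — the YM mass gap (Clay) is NOT
proved by any of this; nothing continuum ∕ ℝ⁴ ∕ OS.  Theorems only: no `def`, no `instance`, no `sorry`, standard axioms.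
-/

noncomputable section

open scoped Matrix.Norms.L2Operator

namespace Summit.QuantumFields.YangMills.BalabanUVNodes.K1EndOfNodes13PWSOfPartialSums

open Literature.MathematicalPhysics.QuantumFieldTheory.Balaban1983to89
open Literature.MathematicalPhysics.QuantumFieldTheory.Balaban1983to89.Node00
open DagBinding T4Continuum T4DatumAssembly FlowStepRuns
open FlowStep (HBeta BetaUpperH prefixOf box_mono mem_box)
open Summit.QuantumFields.YangMills.BalabanUVNodes.K1BetaWindow13SOfNodes13PWSOfBoxH
  (nodes_leavesP_reletter_of_le_all isRecordOfRecord₁₃CSepCoPHS_reletter_of_le)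

/-! ## §1. (2.6) from (0.20): first member from the run-wise ceiling, last member from bounded-below partial sums on a small window -/

section Flow

/-- Telescoping (0.20): `1/g_m² = 1/g_n² + Σ_{j∈[m,n)} β_{j+1}(g_j)` for `m ≤ n ≤ K` (`Step.inv_sq_telescope` at `Flow.SatisfiesRG`). [cite: Balaban1987RG1, (0.20) p.256] -/
theorem inv_sq_eq_add_sum_of_rg (Fl : Flow) {K : ℕ} (hrg : Fl.SatisfiesRG K) {m n : ℕ} (hmn : m ≤ n) (hn : n ≤ K) :
    1 / (Fl.g m) ^ 2 = 1 / (Fl.g n) ^ 2 + ∑ j ∈ Finset.Ico m n, Fl.β (j + 1) (Fl.g j) :=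
  Step.inv_sq_telescope ((Step.rgEq_iff Fl K).1 hrg) hmn hn

/-- **(2.6), first member, from (0.20) + the RUN-WISE ceiling `β_{j+1}(g_j) ≤ β′` + positivity — NO sign condition on `β′`** (the factor `1 + g_n²β′(n−m)` is positive BECAUSE the
squared inequality holds with positive couplings; `Step.B14_2_6a`'s argument with `B14.inv_sq_le_of_rg_upper`). [cite: Balaban1988Convergent, (2.6) p.255; Balaban1987RG1, (0.20) p.256] -/
theorem flow26_upper_of_rg_upper (Fl : Flow) (K : ℕ) {β' : ℝ} (hpos : ∀ j, j ≤ K → 0 < Fl.g j) (hrg : Fl.SatisfiesRG K)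
    (hub : ∀ j, j < K → Fl.β (j + 1) (Fl.g j) ≤ β') :
    ∀ m n, m < n → n ≤ K → Fl.g n ≤ Real.sqrt (1 + (Fl.g n) ^ 2 * β' * ((n : ℝ) - m)) * Fl.g m := by
  intro m n hmn hnK
  have hm : 0 < Fl.g m := hpos m (hmn.le.trans hnK)
  have hn : 0 < Fl.g n := hpos n hnK
  have key := B14.inv_sq_le_of_rg_upper Fl K β' hrg hub m n hmn.le hnK
  have hsq : (Fl.g n) ^ 2 ≤ (1 + (Fl.g n) ^ 2 * β' * ((n : ℝ) - m)) * (Fl.g m) ^ 2 := by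
    have hm2 : 0 < (Fl.g m) ^ 2 := by positivity
    have hn2 : 0 < (Fl.g n) ^ 2 := by positivity
    rw [div_le_iff₀ hm2] at key
    have h2 : (Fl.g n) ^ 2 * 1 ≤ (Fl.g n) ^ 2 * ((1 / (Fl.g n) ^ 2 + β' * ((n : ℝ) - m)) * (Fl.g m) ^ 2) :=
      mul_le_mul_of_nonneg_left key hn2.le
    have h3 : (Fl.g n) ^ 2 * ((1 / (Fl.g n) ^ 2 + β' * ((n : ℝ) - m)) * (Fl.g m) ^ 2) = (1 + (Fl.g n) ^ 2 * β' * ((n : ℝ) - m)) * (Fl.g m) ^ 2 := by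
      field_simp
    linarith [h2, h3]
  have hfac : 0 ≤ 1 + (Fl.g n) ^ 2 * β' * ((n : ℝ) - m) := by
    by_contra hneg
    have : (1 + (Fl.g n) ^ 2 * β' * ((n : ℝ) - m)) * (Fl.g m) ^ 2 < 0 := mul_neg_of_neg_of_pos (lt_of_not_ge hneg) (by positivity)
    nlinarith [sq_nonneg (Fl.g n)]
  calc Fl.g n = Real.sqrt ((Fl.g n) ^ 2) := (Real.sqrt_sq hn.le).symm
    _ ≤ Real.sqrt ((1 + (Fl.g n) ^ 2 * β' * ((n : ℝ) - m)) * (Fl.g m) ^ 2) := Real.sqrt_le_sqrt hsq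
    _ = Real.sqrt (1 + (Fl.g n) ^ 2 * β' * ((n : ℝ) - m)) * Fl.g m := by rw [Real.sqrt_mul hfac, Real.sqrt_sq hm.le]

/-- **(2.6), LAST member, from (0.20) + BOUNDED-BELOW PARTIAL SUMS along the run on a window small against the defect** — NO sign of β: along a run in `]0, γ]` with
`Σ_{j∈[m,n)} β_{j+1}(g_j) ≥ −M` for all `m ≤ n ≤ K` and `M·γ² ≤ 1 − (1+β₀)⁻²`, `β₀ > 0`: `g_m ≤ (1+β₀) g_n` for `m < n ≤ K`.  Reason: `1/g_m² = 1/g_n² + Σ ≥ 1/g_n² − M` and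
`M ≤ (1 − (1+β₀)⁻²)/γ² ≤ (1 − (1+β₀)⁻²)/g_n²`, so `1/g_m² ≥ (1+β₀)⁻²/g_n²`.  (`B14.flow26_lower_of_rg` is the `M = 0` ∕ sign case; the sign is NOT necessary — compare `FlowStepRuns` §7
for the endpoint half.) [cite: Balaban1988Convergent, (2.6) p.255; Balaban1987RG1, (0.20) p.256 and Thm 2 p.259] -/
theorem flow26_lower_of_rg_partialSumsLower (Fl : Flow) (K : ℕ) {β₀ M γ : ℝ} (hβ₀ : 0 < β₀) (hI : Fl.InInterval γ K) (hrg : Fl.SatisfiesRG K)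
    (hps : ∀ m n, m ≤ n → n ≤ K → -M ≤ ∑ j ∈ Finset.Ico m n, Fl.β (j + 1) (Fl.g j)) (hsmall : M * γ ^ 2 ≤ 1 - ((1 + β₀) ^ 2)⁻¹) :
    ∀ m n, m < n → n ≤ K → Fl.g m ≤ (1 + β₀) * Fl.g n := by
  intro m n hmn hnK
  have hm : 0 < Fl.g m := (hI m (hmn.le.trans hnK)).1
  have hn : 0 < Fl.g n := (hI n hnK).1
  have hnγ : Fl.g n ≤ γ := (hI n hnK).2
  have hM : 0 ≤ M := by
    have h0 := hps m m le_rfl (hmn.le.trans hnK)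
    simp only [Finset.Ico_self, Finset.sum_empty] at h0
    linarith
  have htel := inv_sq_eq_add_sum_of_rg Fl hrg hmn.le hnK
  have hS := hps m n hmn.le hnK
  have hMg : M * (Fl.g n) ^ 2 ≤ 1 - ((1 + β₀) ^ 2)⁻¹ :=
    (mul_le_mul_of_nonneg_left (pow_le_pow_left₀ hn.le hnγ 2) hM).trans hsmall
  have hn2 : 0 < (Fl.g n) ^ 2 := by positivity
  have hb2 : 0 < (1 + β₀) ^ 2 := by positivity
  -- 1/((1+β₀) g_n)² ≤ 1/g_m²
  have key : 1 / ((1 + β₀) * Fl.g n) ^ 2 ≤ 1 / (Fl.g m) ^ 2 := by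
    have hMle : M ≤ (1 - ((1 + β₀) ^ 2)⁻¹) / (Fl.g n) ^ 2 := by
      rw [le_div_iff₀ hn2]; exact hMg
    have e : 1 / ((1 + β₀) * Fl.g n) ^ 2 = 1 / (Fl.g n) ^ 2 - (1 - ((1 + β₀) ^ 2)⁻¹) / (Fl.g n) ^ 2 := by
      field_simp
      ring
    rw [e]
    linarith
  have hsq : (Fl.g m) ^ 2 ≤ ((1 + β₀) * Fl.g n) ^ 2 := by
    have hA : 0 < ((1 + β₀) * Fl.g n) ^ 2 := by positivity
    exact (one_div_le_one_div hA (by positivity)).1 key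
  exact (pow_le_pow_iff_left₀ hm.le (by positivity) two_ne_zero).1 hsq

/-- **(2.6) [Balaban1988Convergent] p.255 — BOTH MEMBERS — from (0.20), the run-wise ceiling `β′`, bounded-below partial sums `−M` and the smallness `M·γ² ≤ 1 − (1+β₀)⁻²`** (`β₀ > 0`):
`B14.FlowIneq26 g β′ β₀ K` — the DAG's `flowControl` leaf — WITHOUT the sign of β. [cite: Balaban1988Convergent, (2.6) p.255; Balaban1987RG1, (0.20) p.256] -/
theorem flowIneq26_of_rg_upper_partialSumsLower (Fl : Flow) (K : ℕ) {β' β₀ M γ : ℝ} (hβ₀ : 0 < β₀) (hI : Fl.InInterval γ K) (hrg : Fl.SatisfiesRG K)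
    (hub : ∀ j, j < K → Fl.β (j + 1) (Fl.g j) ≤ β') (hps : ∀ m n, m ≤ n → n ≤ K → -M ≤ ∑ j ∈ Finset.Ico m n, Fl.β (j + 1) (Fl.g j))
    (hsmall : M * γ ^ 2 ≤ 1 - ((1 + β₀) ^ 2)⁻¹) : B14.FlowIneq26 Fl.g β' β₀ K := fun m n hmn hnK =>
  ⟨flow26_upper_of_rg_upper Fl K (fun j hj => (hI j hj).1) hrg hub m n hmn hnK,
    flow26_lower_of_rg_partialSumsLower Fl K hβ₀ hI hrg hps hsmall m n hmn hnK⟩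

end Flow

/-! ## §2. The END headline from the thirteen nodes, the run-wise ceiling and the run-wise partial-sum floor on a small window -/

section Headline

/-- **THE END HEADLINE WITH THE PARTIAL-SUM FLOOR.**  For a dependence-function world `w` with `0 < w.γ`: the thirteen nodes at the `leavesP` binding of every run, the (0.20) leaf
along in-interval runs, the run-wise ceiling `β_{j+1}(g_j) ≤ w.βup` and the run-wise partial-sum floor `Σ_{j∈[m,n)} β_{j+1}(g_j) ≥ −M` along in-interval runs, and the smallness
`M·w.γ² ≤ 1 − (1+w.β₀)⁻²` give the PINNED end statement `B16.EndStatementBPrinted w.C` — `DagBinding.endStatementBPrinted_of_nodesP_interval` with its β-input cut to what (2.6) reads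
(§1).  Pure bookkeeping over `Dag.uv_stability_of_series`. [cite: Balaban1989LargeFieldII, Thm 1 p.355 + p.391; Balaban1988Convergent, (2.6) p.255 and Cor. 3 (2.50) p.264; Balaban1987RG1, (0.20) p.256] -/
theorem endStatementBPrinted_of_nodesP_alongRuns_partialSums (w : WorldP) (hγ : 0 < w.γ) {M : ℝ}
    (hnodes : ∀ P : B12.RunParams, Nodes (leavesP w P)) (hrg : ∀ P : B12.RunParams, (leavesP w P).smallCouplings → (leavesP w P).rgFlow)
    (hhi : ∀ P : B12.RunParams, (leavesP w P).smallCouplings → ∀ j, j < P.K → (w.C P).flow.β (j + 1) ((w.C P).flow.g j) ≤ w.βup)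
    (hps : ∀ P : B12.RunParams, (leavesP w P).smallCouplings → ∀ m n, m ≤ n → n ≤ P.K → -M ≤ ∑ j ∈ Finset.Ico m n, (w.C P).flow.β (j + 1) ((w.C P).flow.g j))
    (hsmall : M * w.γ ^ 2 ≤ 1 - ((1 + w.β₀) ^ 2)⁻¹) : B16.EndStatementBPrinted w.C := by
  refine endStatementBPrinted_of_worldsP w hγ fun P => uvStability_of_nodes (leavesP w P) (hnodes P) ?_
  intro hsc
  exact flowIneq26_of_rg_upper_partialSumsLower (w.C P).flow P.K w.β₀_pos hsc (hrg P hsc) (hhi P hsc) (hps P hsc) hsmall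

end Headline

/-! ## §3. Box letters ⟹ run-wise letters at a construction currying a history family -/

section BoxToRun

/-- The run's history extended constantly (by `g 0`) beyond `K`: a `]0, γ₀]`-valued sequence agreeing with the run below `K`. [cite: Balaban1987RG1, (0.17)–(0.20) pp.255–256 (bookkeeping)] -/
theorem exists_extension_inWindow (g : ℕ → ℝ) {K : ℕ} {γ γ₀ : ℝ} (hγ : γ ≤ γ₀) (hI : Step.InInterval γ K g) :
    ∃ g' : ℕ → ℝ, (∀ i, 0 < g' i ∧ g' i ≤ γ₀) ∧ ∀ i, i ≤ K → g' i = g i := by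
  refine ⟨fun i => if i ≤ K then g i else g 0, fun i => ?_, fun i hi => ?_⟩
  · by_cases hi : i ≤ K
    · have e : (fun i => if i ≤ K then g i else g 0) i = g i := if_pos hi
      rw [e]; exact ⟨(hI i hi).1, (hI i hi).2.trans hγ⟩
    · have e : (fun i => if i ≤ K then g i else g 0) i = g 0 := if_neg hi
      rw [e]; exact ⟨(hI 0 (Nat.zero_le _)).1, (hI 0 (Nat.zero_le _)).2.trans hγ⟩
  · exact if_pos hi

/-- Two sequences agreeing up to `k` have the same `k`-prefix. [cite: Balaban1987RG1, (0.20) p.256 (bookkeeping)] -/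
theorem prefixOf_congr {g g' : ℕ → ℝ} {k : ℕ} (h : ∀ i, i ≤ k → g' i = g i) : prefixOf g' k = prefixOf g k := by
  funext i
  simp only [FlowStep.prefixOf_apply]
  exact h i (Nat.lt_succ_iff.mp i.isLt)

/-- **BOX ⟹ RUN, partial sums**: at a construction whose run-wise β-functions curry the history family `β` (`CurriesHBeta`), `BetaPartialSumsLowerH M γ₀ β` gives, along every run staying
in `]0, γ]`, `γ ≤ γ₀`, the run-wise floor `−M ≤ Σ_{j∈[m,n)} β_{j+1}(g_j)` for `m ≤ n ≤ K` (the run's `β_{j+1}(g_j)` IS `β j (g_0,…,g_j)`, `DagBinding.update_prefixOf_last`).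
[cite: Balaban1987RG1, (0.20) p.256 and Thm 2 p.259 (bookkeeping)] -/
theorem partialSums_alongRun_of_betaPartialSumsLowerH (C : B12.Construction) (β : HBeta) (hcur : CurriesHBeta C β) {M γ₀ γ : ℝ} (hγ : γ ≤ γ₀)
    (hps : BetaPartialSumsLowerH M γ₀ β) (P : B12.RunParams) (hI : (C P).flow.InInterval γ P.K) :
    ∀ m n, m ≤ n → n ≤ P.K → -M ≤ ∑ j ∈ Finset.Ico m n, (C P).flow.β (j + 1) ((C P).flow.g j) := by
  intro m n hmn hnK
  obtain ⟨g', hg', hagree⟩ := exists_extension_inWindow (C P).flow.g hγ hI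
  have h := hps g' hg' m n hmn
  have hsum : ∑ j ∈ Finset.Ico m n, (C P).flow.β (j + 1) ((C P).flow.g j) = ∑ j ∈ Finset.Ico m n, β j (prefixOf g' j) := by
    refine Finset.sum_congr rfl fun j hj => ?_
    have hjK : j < P.K := lt_of_lt_of_le (Finset.mem_Ico.mp hj).2 hnK
    rw [hcur P j _ hjK, update_prefixOf_last, prefixOf_congr fun i hi => hagree i (hi.trans hjK.le)]
  rw [hsum]
  exact h

/-- **BOX ⟹ RUN, ceiling**: `BetaUpperH β⁺ γ₀ β` gives the run-wise ceiling `β_{j+1}(g_j) ≤ β⁺`, `j < K`, along every run in `]0, γ]`, `γ ≤ γ₀`. [cite: Balaban1987RG1, §1 (1.22) p.264 (bookkeeping)] -/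
theorem upper_alongRun_of_betaUpperH (C : B12.Construction) (β : HBeta) (hcur : CurriesHBeta C β) {βup γ₀ γ : ℝ} (hγ : γ ≤ γ₀)
    (hhi : BetaUpperH βup γ₀ β) (P : B12.RunParams) (hI : (C P).flow.InInterval γ P.K) :
    ∀ j, j < P.K → (C P).flow.β (j + 1) ((C P).flow.g j) ≤ βup := by
  intro j hjK
  rw [hcur P j _ hjK, update_prefixOf_last]
  exact hhi j _ (mem_box.mpr fun i => ⟨(hI i ((Nat.lt_succ_iff.mp i.isLt).trans hjK.le)).1, (hI i ((Nat.lt_succ_iff.mp i.isLt).trans hjK.le)).2.trans hγ⟩)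

end BoxToRun

/-! ## §4. ★ The crux's consequent AT θ from any rung-1 datum, the partial-sum floor and the ceiling (window shrunk automatically) -/

section AtTheta

variable {F : T4Family} {N : ℕ} [NeZero N]

/-- **★ THE CRUX's CONSEQUENT AT θ FROM A RUNG-1 DATUM, BOUNDED-BELOW PARTIAL SUMS AND THE CEILING — NO SIGN, NO AF FLOOR.**  Given a unity Stage-13 tuple `θ` with provisos `h`,
`θ.Admissible`, a world `w` in plan's S-bound record class of the datum (`RecordS`, spelled out) all of whose runs' leaf worlds satisfy the thirteen DAG nodes, and on SOME box
`]0, γ₀]^{k+1}`: `FlowStepRuns.BetaPartialSumsLowerH M γ₀ (betaOfRecord₁₃ θ)` (partial sums of the β of record along every `]0, γ₀]`-history bounded below by `−M` — the letter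
K2⁷'s endpoint road consumes, `FlowStepRuns.endpointExistence_of_partialSums`) and `BetaUpperH w.βup γ₀ (betaOfRecord₁₃ θ)`: the body of `StabilityBAtRecordR13SepCoPH` AT θ.  Road:
`M ≥ 0` (empty sum); `c := 1 − (1+w.β₀)⁻² > 0`; shrink the world's window to `γ₁ := min (min w.γ γ₀) √(c∕(M+1))` (companion re-lettering lemmas: nodes kept, S-class kept), so
`M·γ₁² ≤ c`; guarded (0.20) leaf by dag-n10-d's `rgFlow_of_smallCouplings_of_isRecordOfRecord₁₃CSepCoPHS`; run-wise letters by §3 at `(coreOfRecord₁₃CoPH θ).curries`; END by §2;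
`w.C = D.C`; window by n24-a's `N24_window_of_betaUpperH`.  The companion's sign road (`…OfSignBoxH.stabilityB_body_of_rung1At_of_signBoxH`) is the `M = 0` instance
(`FlowStepRuns.betaPartialSumsLowerH_of_sign`); the registered rung 2's AF floor is stronger still.  CONDITIONAL on the two letters; nothing of Bałaban asserted; K1⁷ NOT closed.
[cite: Balaban1989LargeFieldII, Thm 1 p.355 + (0.1) pp.355–356 + p.391; Balaban1988Convergent, (2.6) p.255, Cor. 3 (2.50) p.264; Balaban1987RG1, (0.17)–(0.20) pp.255–256, Thm 2 p.259, §1 (1.22) p.264; Balaban1988Convergent, (0.4) p.235 (non-vacuity)] -/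
theorem stabilityB_body_of_rung1At_of_partialSumsH_of_ceiling (θ : Stage13HParams F N) (h : θ.Provisos₁₃SepCoPH F N) (w : WorldP)
    (hU : θ.ZhUnity F N ∧ θ.SlotsNondegenerate₁₃ F N) (hθ : θ.Admissible F N)
    (hR : ∃ (θ' : Stage13HParams F N) (h' : θ'.Provisos₁₃SepCoPH F N), θ'.Admissible F N ∧
      datumOfRecord₁₃SepCoPH F N θ h = datumOfRecord₁₃SepCoPH F N θ' h' ∧ w.C = (datumOfRecord₁₃SepCoPH F N θ h).C ∧ (0 < w.γ ∧ w.γ ≤ θ'.γ) ∧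
      w.L = (θ'.L : ℝ) ∧ ∀ P : B12.RunParams, w.up P = upOfRecord₅CS F N (θ'.toStage5₁₃CoPH F N) P)
    (hnodes : ∀ P : B12.RunParams, Nodes (leavesP w P))
    {γ₀ M : ℝ} (hγ₀ : 0 < γ₀)
    (hps : BetaPartialSumsLowerH M γ₀ (betaOfRecord₁₃ F N θ.toStage13Params)) (hhi : BetaUpperH w.βup γ₀ (betaOfRecord₁₃ F N θ.toStage13Params)) :
    (θ.ZhUnity F N ∧ θ.SlotsNondegenerate₁₃ F N) ∧ θ.Admissible F N ∧ B16.EndStatementBPrinted (datumOfRecord₁₃SepCoPH F N θ h).C ∧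
      ∃ γ₁ : ℝ, 0 < γ₁ ∧ ∀ γ : ℝ, 0 < γ → γ ≤ γ₁ → ∃ P : B12.RunParams, 1 ≤ P.K ∧ ((datumOfRecord₁₃SepCoPH F N θ h).C P).flow.InInterval γ P.K := by
  have hRS : IsRecordOfRecord₁₃CSepCoPHS F N (datumOfRecord₁₃SepCoPH F N θ h) w := (recordS₁₃SepCoPH_iff F N θ h w).1 hR
  have hγw : 0 < w.γ := gamma_pos_of_isRecordOfRecord₁₃CSepCoPHS hRS
  have hC : w.C = (datumOfRecord₁₃SepCoPH F N θ h).C := construction_eq_of_isRecordOfRecord₁₃CSepCoPHS hRS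
  -- M ≥ 0 from the empty sum along the constant history γ₀
  have hM : 0 ≤ M := by
    have h0 := hps (fun _ => γ₀) (fun _ => ⟨hγ₀, le_rfl⟩) 0 0 le_rfl
    simp only [Finset.Ico_self, Finset.sum_empty] at h0
    linarith
  -- the smallness constant and the shrunk window
  set c : ℝ := 1 - ((1 + w.β₀) ^ 2)⁻¹ with hc_def
  have hc : 0 < c := by
    have h1 : 1 < (1 + w.β₀) ^ 2 := by nlinarith [w.β₀_pos]
    have h2 : ((1 + w.β₀) ^ 2)⁻¹ < 1 := inv_lt_one_of_one_lt₀ h1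
    rw [hc_def]; linarith
  set γM : ℝ := Real.sqrt (c / (M + 1)) with hγM_def
  have hγM : 0 < γM := Real.sqrt_pos.mpr (by positivity)
  set γ₁ : ℝ := min (min w.γ γ₀) γM with hγ₁_def
  have hγ₁ : 0 < γ₁ := lt_min (lt_min hγw hγ₀) hγM
  have hγ₁w : γ₁ ≤ w.γ := (min_le_left _ _).trans (min_le_left _ _)
  have hγ₁₀ : γ₁ ≤ γ₀ := (min_le_left _ _).trans (min_le_right _ _)
  have hsmall : M * γ₁ ^ 2 ≤ c := by
    have h1 : γ₁ ^ 2 ≤ γM ^ 2 := pow_le_pow_left₀ hγ₁.le (min_le_right _ _) 2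
    have h2 : γM ^ 2 = c / (M + 1) := by rw [hγM_def, Real.sq_sqrt (by positivity)]
    have h3 : M * (c / (M + 1)) ≤ c := by
      rw [mul_div_assoc']
      rw [div_le_iff₀ (by positivity)]
      nlinarith [hc, hM]
    calc M * γ₁ ^ 2 ≤ M * γM ^ 2 := mul_le_mul_of_nonneg_left h1 hM
      _ = M * (c / (M + 1)) := by rw [h2]
      _ ≤ c := h3
  -- the re-lettered world
  have hRS' : IsRecordOfRecord₁₃CSepCoPHS F N (datumOfRecord₁₃SepCoPH F N θ h) { w with γ := γ₁, b := w.b, b_pos := w.b_pos } :=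
    isRecordOfRecord₁₃CSepCoPHS_reletter_of_le hRS hγ₁ hγ₁w w.b_pos
  have hcur : CurriesHBeta (datumOfRecord₁₃SepCoPH F N θ h).C.toB12 (betaOfRecord₁₃ F N θ.toStage13Params) :=
    (coreOfRecord₁₃CoPH F N θ).curries (fun p k => densOfRecord₁₃ F N θ.toStage13Params p k)
  have hB : B16.EndStatementBPrinted ({ w with γ := γ₁, b := w.b, b_pos := w.b_pos } : WorldP).C := by
    refine endStatementBPrinted_of_nodesP_alongRuns_partialSums { w with γ := γ₁, b := w.b, b_pos := w.b_pos } hγ₁ (M := M)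
      (nodes_leavesP_reletter_of_le_all w hγ₁w w.b_pos hnodes)
      (fun P hsc => rgFlow_of_smallCouplings_of_isRecordOfRecord₁₃CSepCoPHS hRS' P hsc) (fun P hsc => ?_) (fun P hsc => ?_) hsmall
    · have hsc' : ((datumOfRecord₁₃SepCoPH F N θ h).C.toB12 P).flow.InInterval γ₁ P.K := by
        show ((datumOfRecord₁₃SepCoPH F N θ h).C P).flow.InInterval γ₁ P.K
        rw [← hC]; exact hsc
      show ∀ j, j < P.K → (w.C P).flow.β (j + 1) ((w.C P).flow.g j) ≤ w.βup
      rw [hC]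
      exact upper_alongRun_of_betaUpperH (datumOfRecord₁₃SepCoPH F N θ h).C.toB12 _ hcur hγ₁₀ hhi P hsc'
    · have hsc' : ((datumOfRecord₁₃SepCoPH F N θ h).C.toB12 P).flow.InInterval γ₁ P.K := by
        show ((datumOfRecord₁₃SepCoPH F N θ h).C P).flow.InInterval γ₁ P.K
        rw [← hC]; exact hsc
      show ∀ m n, m ≤ n → n ≤ P.K → -M ≤ ∑ j ∈ Finset.Ico m n, (w.C P).flow.β (j + 1) ((w.C P).flow.g j)
      rw [hC]
      exact partialSums_alongRun_of_betaPartialSumsLowerH (datumOfRecord₁₃SepCoPH F N θ h).C.toB12 _ hcur hγ₁₀ hps P hsc'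
  refine ⟨hU, hθ, ?_, N24_window_of_betaUpperH (datumOfRecord₁₃SepCoPH F N θ h) hγ₀ hhi⟩
  have : ({ w with γ := γ₁, b := w.b, b_pos := w.b_pos } : WorldP).C = (datumOfRecord₁₃SepCoPH F N θ h).C := hC
  rw [← this]
  exact hB

end AtTheta


/-! ## §5. ★★★ `N = 2`: the ROUTE DECL BY NAME from the registered STUB 1 text and the partial-sum box at every rung-1 witness -/

section Registered

/-- **★★★ K1⁷ BY NAME FROM THE REGISTERED STUB 1 AND «PARTIAL SUMS BOUNDED BELOW + CEILING» AT EVERY RUNG-1 WITNESS** — an ALTERNATIVE kernel-checked composition beside plan's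
`StabilityBAtRecordR13SepCoPH_of stub_nodes13PWS stub_betaWindow13PWS`: `h₁` = the registered STUB 1 `∀ F, Inhabited13 F → NodesAtSomeRecord13PWS F` (v5 texts VERBATIM, `RecordS`
unfolded); `hps` = «for every `F`, at every rung-1 witness `(θ, h, w)`: `∃ γ₀ M, 0 < γ₀ ∧ BetaPartialSumsLowerH M γ₀ β_θ ∧ BetaUpperH w.βup γ₀ β_θ`» — NO sign, NO AF floor (two notches
BELOW the registered rung 2's `0 < w.b ≤ β`; the partial-sum letter is K2⁷'s own endpoint currency).  Conclusion: `Summit.QuantumFields.YangMills.Theses.BalabanUVNodes.StabilityBAtRecordR13SepCoPH`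
— the TYPE is the route decl literally.  CONDITIONAL on both hypotheses (neither supplied here); K1⁷ is NOT closed by this theorem; nothing of Bałaban asserted; no count moved.
[cite: Balaban1989LargeFieldII, Thm 1 p.355 + (0.1) pp.355–356 + p.391; Balaban1988Convergent, (2.6) p.255 and Cor. 3 (2.50) p.264; Balaban1987RG1, Thm 2 p.259, §1 (1.22) p.264 (bookkeeping)] -/
theorem stabilityBAtRecordR13SepCoPH_of_stub1_of_partialSumsBox_at_witness
    (h₁ : ∀ F : T4Family, (∃ θ : Stage13HParams F 2, θ.Provisos₁₃SepCoPH F 2 ∧ (θ.ZhUnity F 2 ∧ θ.SlotsNondegenerate₁₃ F 2) ∧ θ.Admissible F 2) →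
      ∃ (θ : Stage13HParams F 2) (h : θ.Provisos₁₃SepCoPH F 2) (w : WorldP), (θ.ZhUnity F 2 ∧ θ.SlotsNondegenerate₁₃ F 2) ∧ θ.Admissible F 2 ∧
        (∃ (θ' : Stage13HParams F 2) (h' : θ'.Provisos₁₃SepCoPH F 2), θ'.Admissible F 2 ∧
          datumOfRecord₁₃SepCoPH F 2 θ h = datumOfRecord₁₃SepCoPH F 2 θ' h' ∧ w.C = (datumOfRecord₁₃SepCoPH F 2 θ h).C ∧ (0 < w.γ ∧ w.γ ≤ θ'.γ) ∧
          w.L = (θ'.L : ℝ) ∧ ∀ P : B12.RunParams, w.up P = upOfRecord₅CS F 2 (θ'.toStage5₁₃CoPH F 2) P) ∧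
        (∀ P : B12.RunParams, Nodes (leavesP w P)) ∧ PrintedUV3V 2 θ.L ∧
        ∃ lam : ResidW F 2, (∀ P : B12.RunParams, 1 ≤ P.K → lam.kSel P < P.K) ∧
          ∀ P : B12.RunParams, lam.kSel P < P.K → ((leavesP w P).rBasicStep ↔ B15Leaf (WOfRecord₁₃ F 2 θ.toStage13Params lam P)))
    (hps : ∀ (F : T4Family) (θ : Stage13HParams F 2) (h : θ.Provisos₁₃SepCoPH F 2) (w : WorldP),
      (θ.ZhUnity F 2 ∧ θ.SlotsNondegenerate₁₃ F 2) → θ.Admissible F 2 →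
      (∃ (θ' : Stage13HParams F 2) (h' : θ'.Provisos₁₃SepCoPH F 2), θ'.Admissible F 2 ∧
        datumOfRecord₁₃SepCoPH F 2 θ h = datumOfRecord₁₃SepCoPH F 2 θ' h' ∧ w.C = (datumOfRecord₁₃SepCoPH F 2 θ h).C ∧ (0 < w.γ ∧ w.γ ≤ θ'.γ) ∧
        w.L = (θ'.L : ℝ) ∧ ∀ P : B12.RunParams, w.up P = upOfRecord₅CS F 2 (θ'.toStage5₁₃CoPH F 2) P) →
      (∀ P : B12.RunParams, Nodes (leavesP w P)) → PrintedUV3V 2 θ.L →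
      (∃ lam : ResidW F 2, (∀ P : B12.RunParams, 1 ≤ P.K → lam.kSel P < P.K) ∧
        ∀ P : B12.RunParams, lam.kSel P < P.K → ((leavesP w P).rBasicStep ↔ B15Leaf (WOfRecord₁₃ F 2 θ.toStage13Params lam P))) →
      ∃ γ₀ M : ℝ, 0 < γ₀ ∧ BetaPartialSumsLowerH M γ₀ (betaOfRecord₁₃ F 2 θ.toStage13Params) ∧ BetaUpperH w.βup γ₀ (betaOfRecord₁₃ F 2 θ.toStage13Params)) :
    Summit.QuantumFields.YangMills.Theses.BalabanUVNodes.StabilityBAtRecordR13SepCoPH := by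
  intro F hinh
  obtain ⟨θ, h, w, hU, hθ, hR, hnodes, h08, hlam⟩ := h₁ F hinh
  obtain ⟨γ₀, M, hγ₀, hpsθ, hhi⟩ := hps F θ h w hU hθ hR hnodes h08 hlam
  exact ⟨θ, h, stabilityB_body_of_rung1At_of_partialSumsH_of_ceiling θ h w hU hθ hR hnodes hγ₀ hpsθ hhi⟩

end Registered



end Summit.QuantumFields.YangMills.BalabanUVNodes.K1EndOfNodes13PWSOfPartialSums

end
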